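import Mathlib
import Summits.MatrixMultiplication.MatrixMultiplication.Theorems.SnSubsetDichotomyHyperoctahedralThresholdTwinSupplyCSCyclic

/-!
# Pointwise transporter bound from closed-walk sparsity (no mixing)

Helper for crux `SnSubsetDichotomy.HyperoctahedralThreshold` (stmt-MatrixMultiplication-10883), line
`STUB-PLAN-stub_poorRigidCore` / `Lines/stub_plan_poorRigidCore.md` (clean-pair atom, depth recursion).

For a vertex `ρ` and a length `t`, let `tr_t(ρ,u)` be the number of reduced colour words of length `t` carrying `ρ`
to `u`, and `cw_m(ρ) = |closedAt μ m ρ|` the number of reduced closed walks of length `m` at `ρ`.  Pairs of words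
with the same endpoint are `pairsAt`, so `tr_t(ρ,u)² ≤ |pairsAt μ t ρ| = |RW t| + |collAt μ t ρ|`, and the tree's
`TwinSupplyCS.card_collAt_le_sum` bounds the collisions by `∑_{i<t} 2^i · cw_{2(t-i)}(ρ)` (split at the longest
common suffix; crux NOTES §C1).  Hence, if `ρ` is NOT a dense spot up to length `2t`
(`s₀ · cw_m(ρ) ≤ 2^m` for `1 ≤ m ≤ 2t`), then  `s₀ · tr_t(ρ,u)² ≤ 3·s₀·2^t + 2·4^t`  for every target `u`:
at most `≈ √3·2^{t/2}` words reach the same vertex while `2^t ≤ s₀`, and at most `≈ 2^t·√(2/s₀)` beyond.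
This is the only "expansion-like" input of the depth recursion, and it is pointwise in the SOURCE vertex.
-/

-- the tree's namespace `Summit.MatrixMultiplication.MatrixMultiplication.…` repeats a component by design
set_option linter.dupNamespace false

namespace Summit.MatrixMultiplication.MatrixMultiplication.Theorems.HyperoctahedralThreshold

namespace Transporter

open Finset TwinSupplyCS

variable {α : Type*} [DecidableEq α]

/-- `tr_t(ρ,u)² ≤ |pairsAt μ t ρ|`: the square of a fibre embeds into the pairs with equal endpoint. -/
theorem card_trAt_sq_le_pairsAt (μ : Fin 3 → Equiv.Perm α) (t : ℕ) (ρ u : α) :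
    ((RW t).filter fun w => act μ ρ w = u).card ^ 2 ≤ (pairsAt μ t ρ).card := by
  rw [sq, ← card_product]
  refine card_le_card ?_
  rintro ⟨w, w'⟩ h
  rw [mem_product, mem_filter, mem_filter] at h
  rw [mem_pairsAt]
  exact ⟨⟨h.1.1, h.2.1⟩, by rw [h.1.2, h.2.2]⟩

/-- **Transporter bound, closed-walk form**: `tr_t(ρ,u)² ≤ |RW t| + ∑_{i<t} 2^i · cw_{2(t-i)}(ρ)`. -/
theorem card_trAt_sq_le (μ : Fin 3 → Equiv.Perm α) (hμ : ∀ c, Function.Involutive (μ c)) (t : ℕ) (ρ u : α) :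
    ((RW t).filter fun w => act μ ρ w = u).card ^ 2 ≤ (RW t).card + ∑ i ∈ range t, 2 ^ i * (closedAt μ (2 * (t - i)) ρ).card :=
  (card_trAt_sq_le_pairsAt μ t ρ u).trans <| by
    rw [card_pairsAt]
    exact Nat.add_le_add_left (card_collAt_le_sum μ hμ t ρ) _

/-- The geometric sum `∑_{i<t} 2^i · 2^(2(t-i)) ≤ 2 · 4^t`. -/
theorem sum_pow_le (t : ℕ) : ∑ i ∈ range t, 2 ^ i * 2 ^ (2 * (t - i)) ≤ 2 * 4 ^ t := by
  have h : ∀ i ∈ range t, 2 ^ i * 2 ^ (2 * (t - i)) = 4 ^ t / 2 ^ i := by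
    intro i hi
    rw [mem_range] at hi
    have : 4 ^ t = 2 ^ i * 2 ^ (2 * (t - i)) * 2 ^ i := by
      rw [show (4 : ℕ) = 2 ^ 2 by norm_num, ← pow_mul, ← pow_add, ← pow_add]
      congr 1; omega
    rw [this, Nat.mul_div_cancel _ (by positivity)]
  rw [sum_congr rfl h]
  -- `∑_{i<s} x/2^i + 2·(x/2^s) ≤ 2x` in ℕ (floors only help), by induction on `s`
  have key : ∀ s : ℕ, ∑ i ∈ range s, 4 ^ t / 2 ^ i + 2 * (4 ^ t / 2 ^ s) ≤ 2 * 4 ^ t := by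
    intro s
    induction s with
    | zero => simp
    | succ s ih =>
      rw [sum_range_succ]
      have h2 : 4 ^ t / 2 ^ (s + 1) = 4 ^ t / 2 ^ s / 2 := by
        rw [pow_succ, Nat.div_div_eq_div_mul]
      rw [h2]
      omega
  exact le_trans (Nat.le_add_right _ _) (key t)

/-- **Transporter bound at a non-dense source.**  If `s₀ · cw_m(ρ) ≤ 2^m` for all `1 ≤ m ≤ 2t`, then for every
target `u`:  `s₀ · tr_t(ρ,u)² ≤ 3 · s₀ · 2^t + 2 · 4^t`. -/
theorem card_trAt_sq_le_of_sparse (μ : Fin 3 → Equiv.Perm α) (hμ : ∀ c, Function.Involutive (μ c))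
    (t s₀ : ℕ) (ρ u : α)
    (hsparse : ∀ m, 1 ≤ m → m ≤ 2 * t → s₀ * (closedAt μ m ρ).card ≤ 2 ^ m) :
    s₀ * ((RW t).filter fun w => act μ ρ w = u).card ^ 2 ≤ 3 * s₀ * 2 ^ t + 2 * 4 ^ t := by
  have h1 := Nat.mul_le_mul_left s₀ (card_trAt_sq_le μ hμ t ρ u)
  rw [mul_add, mul_sum] at h1
  have hRW : (RW t).card ≤ 3 * 2 ^ t := by
    rcases Nat.eq_zero_or_pos t with rfl | ht
    · simp [TwinSupplyCS.RW_zero]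
    · rw [TwinSupplyCS.card_RW ht]
      exact Nat.mul_le_mul_left 3 (Nat.pow_le_pow_right (by norm_num) (Nat.sub_le t 1))
  have h2 : ∑ i ∈ range t, s₀ * (2 ^ i * (closedAt μ (2 * (t - i)) ρ).card) ≤
      ∑ i ∈ range t, 2 ^ i * 2 ^ (2 * (t - i)) := by
    refine sum_le_sum fun i hi => ?_
    rw [mem_range] at hi
    rw [mul_left_comm]
    exact Nat.mul_le_mul_left _ (hsparse _ (by omega) (by omega))
  calc s₀ * ((RW t).filter fun w => act μ ρ w = u).card ^ 2
      ≤ s₀ * (RW t).card + ∑ i ∈ range t, s₀ * (2 ^ i * (closedAt μ (2 * (t - i)) ρ).card) := h1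
    _ ≤ s₀ * (3 * 2 ^ t) + 2 * 4 ^ t := Nat.add_le_add (Nat.mul_le_mul_left _ hRW) (h2.trans (sum_pow_le t))
    _ = 3 * s₀ * 2 ^ t + 2 * 4 ^ t := by ring

end Transporter

open TwinSupplyCS Transporter in
/-- **`stub_transporterBound`** (registered sub-goal of stmt-MatrixMultiplication-10883, tree vocabulary): if
`s₀ · cw_m(ρ) ≤ 2^m` for `1 ≤ m ≤ 2t` (the source `ρ` is not a dense spot), then every target `u` is reached by
few reduced words of length `t`:  `s₀ · tr_t(ρ,u)² ≤ 3·s₀·2^t + 2·4^t`. -/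
theorem stub_transporterBound : ∀ (n t s₀ : ℕ) (μ : Fin 3 → Equiv.Perm (Fin n)) (ρ u : Fin n), (∀ c, μ c * μ c = 1) → (∀ m, 1 ≤ m → m ≤ 2 * t → s₀ * ((((Finset.univ : Finset (List.Vector (Fin 3) m)).image (fun v => v.toList)).filter (fun g => List.IsChain (· ≠ ·) g)).filter (fun w => w.foldl (fun v c => μ c v) ρ = ρ)).card ≤ 2 ^ m) → s₀ * ((((Finset.univ : Finset (List.Vector (Fin 3) t)).image (fun v => v.toList)).filter (fun g => List.IsChain (· ≠ ·) g)).filter (fun w => w.foldl (fun v c => μ c v) ρ = u)).card ^ 2 ≤ 3 * s₀ * 2 ^ t + 2 * 4 ^ t := by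
  intro n t s₀ μ ρ u hμ hsparse
  have h := card_trAt_sq_le_of_sparse μ (involutive_of_mul_self μ hμ) t s₀ ρ u (fun m h1 h2 => by
    have := hsparse m h1 h2
    rwa [← RW_eq_vector] at this)
  rwa [← RW_eq_vector]

end Summit.MatrixMultiplication.MatrixMultiplication.Theorems.HyperoctahedralThreshold
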